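import Summits.Ventures.PercRepro.RankLevelSetRuleQSliceSecondUntruncLarge

/-!
# PercRepro — THE SQUARE-ROOT BAND: EVERY SLICE `k − 1 ≤ u` WITH `4(u+k)² ≤ q − u` IS PAID, EVERY FAMILY `k ≥ 5`
(night-1, gen 22; dossier §33)

The climb of RankLevelSetRuleQSliceBorderClimb / SecondUntruncLarge, iterated: at a fixed `q` the slice `u + 1` follows from
the slice `u` through the tree's `phiK_le_rhat_of_sliceStep` whenever `C(u+k, k−1)·S_k(q, m) ≤ S_1(q, m)` (`q = m + 1 + u`).
With the moment bounds this holds as soon as `4u² ≤ m` and `(u+k)² ≤ m + 2`: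
* `choose_diag_log_concave` — `C(q+j+a, a+j)·C(q+j+2+a, a+j+2) ≤ C(q+j+1+a, a+j+1)²` (the diagonal of Pascal's triangle is
  log-concave); hence **`sliceS_sq_le`** — the slice sums are LOG-CONVEX in `j`: `S_{j+1}(q, m)² ≤ S_j(q, m)·S_{j+2}(q, m)`
  (Cauchy–Schwarz in Engel form); this is what the even families need (`J_{2d+2}² ≤ J_{2d+1}·J_{2d+3}` in closed form);
* `band_odd` / `band_even` — the binomial inequalities `2·C(n, 2d) ≤ C(m+d+1, d)` and `4·C(n, 2d+1)² ≤ C(m+d+1, d)·C(m+d+2, d+1)`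
  for `n² ≤ m + 2` (`C(n, r) ≤ n^r/r!`, `(m+2)^d ≤ d!·C(m+d+1, d)`, `2·d! ≤ (2d)!`, `4·d!(d+1)! ≤ ((2d+1)!)²`);
* **`band_step`** — the monotone step `C(u+k, k−1)·S_k(q, m) ≤ S_1(q, m)` under `4u² ≤ m`, `(u+k)² ≤ m + 2`;
* **`slice_band`** — `Φ(q+k, q) ≤ R̂(q, k, q − u)` for every `k ≥ 5`, `k − 1 ≤ u ≤ q` with `4(u+k)² ≤ q − u` (induction on
  `u − (k−1)` from `first_untrunc_slice_every`); **`ruleQRecv_ge_phiK_band`** — the matroid level: at the tight layer every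
  member at distance `u` from the top with `k − 1 ≤ u` and `4(u+k)² ≤ q − u` is paid by Rule Q's equal split.
Axioms: standard.
-/

namespace PercRepro

open Finset

/-! ### §1 Log-convexity of the slice sums in the degree -/

/-- The diagonal of Pascal's triangle is log-concave: `C(n, r)·C(n+2, r+2) ≤ C(n+1, r+1)²` for `r ≤ n`. -/
lemma choose_diag_log_concave (n r : ℕ) (h : r ≤ n) :
    n.choose r * (n + 2).choose (r + 2) ≤ ((n + 1).choose (r + 1)) ^ 2 := by
  have e1 := Nat.add_one_mul_choose_eq n r            -- (n+1) C(n,r) = C(n+1,r+1) (r+1)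
  have e2 := Nat.add_one_mul_choose_eq (n + 1) (r + 1) -- (n+2) C(n+1,r+1) = C(n+2,r+2) (r+2)
  rw [show n + 1 + 1 = n + 2 by ring, show r + 1 + 1 = r + 2 by ring] at e2
  have key : (n + 1) * (r + 2) * (n.choose r * (n + 2).choose (r + 2))
      ≤ (n + 1) * (r + 2) * ((n + 1).choose (r + 1)) ^ 2 := by
    calc (n + 1) * (r + 2) * (n.choose r * (n + 2).choose (r + 2))
        = ((n + 1) * n.choose r) * ((r + 2) * (n + 2).choose (r + 2)) := by ring
      _ = ((n + 1).choose (r + 1) * (r + 1)) * ((n + 2) * (n + 1).choose (r + 1)) := by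
          rw [e1, mul_comm (r + 2), ← e2]
      _ = (r + 1) * (n + 2) * ((n + 1).choose (r + 1)) ^ 2 := by ring
      _ ≤ (n + 1) * (r + 2) * ((n + 1).choose (r + 1)) ^ 2 := by
          apply Nat.mul_le_mul_right
          nlinarith
  exact Nat.le_of_mul_le_mul_left key (by positivity)

/-- **Log-convexity of the slice sums in `j`**: `S_{j+1}(q, m)² ≤ S_j(q, m)·S_{j+2}(q, m)` (Cauchy–Schwarz in Engel form
on the terms, with `choose_diag_log_concave` termwise). -/
lemma sliceS_sq_le (q m j : ℕ) : sliceS q m (j + 1) ^ 2 ≤ sliceS q m j * sliceS q m (j + 2) := by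
  unfold sliceS
  have hg : ∀ a ∈ range (m + 1), (0 : ℚ) < (m.choose a : ℚ) / ((q + j + a).choose (a + j) : ℚ) := by
    intro a ha
    rw [Finset.mem_range] at ha
    exact div_pos (Nat.cast_pos.mpr (Nat.choose_pos (by omega))) (Nat.cast_pos.mpr (Nat.choose_pos (by omega)))
  have hE := Finset.sq_sum_div_le_sum_sq_div (range (m + 1))
    (fun a => (m.choose a : ℚ) / ((q + (j + 1) + a).choose (a + (j + 1)) : ℚ)) hg
  have hS : (0 : ℚ) < ∑ a ∈ range (m + 1), (m.choose a : ℚ) / ((q + j + a).choose (a + j) : ℚ) :=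
    Finset.sum_pos hg ⟨0, Finset.mem_range.mpr (Nat.succ_pos _)⟩
  rw [div_le_iff₀ hS] at hE
  refine hE.trans ?_
  rw [mul_comm]
  apply mul_le_mul_of_nonneg_left _ hS.le
  refine Finset.sum_le_sum (fun a ha => ?_)
  rw [Finset.mem_range] at ha
  have hlc := choose_diag_log_concave (q + j + a) (a + j) (by omega)
  rw [show q + j + a + 2 = q + (j + 2) + a by ring, show q + j + a + 1 = q + (j + 1) + a by ring,
    show a + j + 2 = a + (j + 2) by ring, show a + j + 1 = a + (j + 1) by ring] at hlc
  have hlcq : ((q + j + a).choose (a + j) : ℚ) * ((q + (j + 2) + a).choose (a + (j + 2)) : ℚ)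
      ≤ (((q + (j + 1) + a).choose (a + (j + 1)) : ℚ)) ^ 2 := by exact_mod_cast hlc
  have h0 : (0 : ℚ) < (m.choose a : ℚ) := Nat.cast_pos.mpr (Nat.choose_pos (by omega))
  have h1 : (0 : ℚ) < ((q + j + a).choose (a + j) : ℚ) := Nat.cast_pos.mpr (Nat.choose_pos (by omega))
  have h2 : (0 : ℚ) < ((q + (j + 1) + a).choose (a + (j + 1)) : ℚ) := Nat.cast_pos.mpr (Nat.choose_pos (by omega))
  have h3 : (0 : ℚ) < ((q + (j + 2) + a).choose (a + (j + 2)) : ℚ) := Nat.cast_pos.mpr (Nat.choose_pos (by omega))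
  have hL : ((m.choose a : ℚ) / ((q + (j + 1) + a).choose (a + (j + 1)) : ℚ)) ^ 2
        / ((m.choose a : ℚ) / ((q + j + a).choose (a + j) : ℚ))
      = (m.choose a : ℚ) * ((q + j + a).choose (a + j) : ℚ)
        / (((q + (j + 1) + a).choose (a + (j + 1)) : ℚ)) ^ 2 := by
    field_simp
  rw [hL, div_le_div_iff₀ (by positivity) (by positivity)]
  have := mul_le_mul_of_nonneg_left hlcq h0.le
  nlinarith [this]

/-! ### §2 The binomial inequalities of the band -/

/-- `(m+2)^d ≤ d!·C(m+d+1, d)`. -/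
lemma pow_le_factorial_mul_choose (m d : ℕ) : (m + 2) ^ d ≤ d.factorial * (m + d + 1).choose d := by
  have h := Nat.pow_sub_le_descFactorial (m + d + 1) d
  rw [show m + d + 1 + 1 - d = m + 2 by omega, Nat.descFactorial_eq_factorial_mul_choose] at h
  exact h

/-- `2·d! ≤ (2d)!` for `d ≥ 1`. -/
lemma two_mul_factorial_le (d : ℕ) (hd : 1 ≤ d) : 2 * d.factorial ≤ (2 * d).factorial := by
  have h := Nat.factorial_mul_pow_le_factorial (m := d) (n := d)
  rw [show d + d = 2 * d by ring] at h
  have h2 : 2 ≤ (d + 1) ^ d := by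
    calc 2 ≤ d + 1 := by omega
      _ ≤ (d + 1) ^ d := Nat.le_self_pow (by omega) _
  calc 2 * d.factorial ≤ (d + 1) ^ d * d.factorial := Nat.mul_le_mul_right _ h2
    _ = d.factorial * (d + 1) ^ d := by ring
    _ ≤ (2 * d).factorial := h

/-- `4·d!·(d+1)! ≤ ((2d+1)!)²` for `d ≥ 1`. -/
lemma four_mul_factorial_le_sq (d : ℕ) (hd : 1 ≤ d) :
    4 * (d.factorial * (d + 1).factorial) ≤ ((2 * d + 1).factorial) ^ 2 := by
  have h1 := Nat.factorial_mul_pow_le_factorial (m := d) (n := d + 1)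
  have h2 := Nat.factorial_mul_pow_le_factorial (m := d + 1) (n := d)
  rw [show d + (d + 1) = 2 * d + 1 by ring] at h1
  rw [show d + 1 + d = 2 * d + 1 by ring] at h2
  have h3 : 4 ≤ (d + 1) ^ (d + 1) := by
    calc 4 = 2 ^ 2 := by norm_num
      _ ≤ (d + 1) ^ 2 := Nat.pow_le_pow_left (by omega) 2
      _ ≤ (d + 1) ^ (d + 1) := Nat.pow_le_pow_right (by omega) (by omega)
  have h4 : 1 ≤ (d + 1 + 1) ^ d := Nat.one_le_pow _ _ (by omega)
  calc 4 * (d.factorial * (d + 1).factorial)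
      ≤ ((d + 1) ^ (d + 1) * (d + 1 + 1) ^ d) * (d.factorial * (d + 1).factorial) := by
        apply Nat.mul_le_mul_right
        calc 4 = 4 * 1 := by ring
          _ ≤ (d + 1) ^ (d + 1) * (d + 1 + 1) ^ d := Nat.mul_le_mul h3 h4
    _ = (d.factorial * (d + 1) ^ (d + 1)) * ((d + 1).factorial * (d + 1 + 1) ^ d) := by ring
    _ ≤ (2 * d + 1).factorial * (2 * d + 1).factorial := Nat.mul_le_mul h1 h2
    _ = ((2 * d + 1).factorial) ^ 2 := by ring

/-- **The odd band inequality**: `2·C(n, 2d) ≤ C(m+d+1, d)` whenever `n² ≤ m + 2` (`d ≥ 1`). -/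
lemma band_odd (d n m : ℕ) (hd : 1 ≤ d) (h : n ^ 2 ≤ m + 2) :
    2 * (n.choose (2 * d) : ℚ) ≤ ((m + d + 1).choose d : ℚ) := by
  have hc : (n.choose (2 * d) : ℚ) ≤ (n : ℚ) ^ (2 * d) / ((2 * d).factorial : ℚ) := Nat.choose_le_pow_div (2 * d) n
  have hp : ((n : ℚ)) ^ (2 * d) ≤ ((m : ℚ) + 2) ^ d := by
    rw [pow_mul]
    have : ((n : ℚ)) ^ 2 ≤ (m : ℚ) + 2 := by exact_mod_cast h
    exact pow_le_pow_left₀ (by positivity) this d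
  have hdf : ((m : ℚ) + 2) ^ d ≤ (d.factorial : ℚ) * ((m + d + 1).choose d : ℚ) := by
    exact_mod_cast pow_le_factorial_mul_choose m d
  have hf : 2 * (d.factorial : ℚ) ≤ ((2 * d).factorial : ℚ) := by exact_mod_cast two_mul_factorial_le d hd
  have hf0 : (0 : ℚ) < (d.factorial : ℚ) := by positivity
  have hf1 : (0 : ℚ) < ((2 * d).factorial : ℚ) := by positivity
  calc 2 * (n.choose (2 * d) : ℚ) ≤ 2 * ((n : ℚ) ^ (2 * d) / ((2 * d).factorial : ℚ)) := by gcongr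
    _ ≤ 2 * (((m : ℚ) + 2) ^ d / ((2 * d).factorial : ℚ)) := by gcongr
    _ ≤ 2 * (((m : ℚ) + 2) ^ d / (2 * (d.factorial : ℚ))) := by gcongr
    _ = ((m : ℚ) + 2) ^ d / (d.factorial : ℚ) := by field_simp
    _ ≤ ((m + d + 1).choose d : ℚ) := by rw [div_le_iff₀ hf0]; linarith

/-- **The even band inequality**: `4·C(n, 2d+1)² ≤ C(m+d+1, d)·C(m+d+2, d+1)` whenever `n² ≤ m + 2` (`d ≥ 1`). -/
lemma band_even (d n m : ℕ) (hd : 1 ≤ d) (h : n ^ 2 ≤ m + 2) :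
    4 * (n.choose (2 * d + 1) : ℚ) ^ 2 ≤ ((m + d + 1).choose d : ℚ) * ((m + d + 2).choose (d + 1) : ℚ) := by
  have hc : (n.choose (2 * d + 1) : ℚ) ≤ (n : ℚ) ^ (2 * d + 1) / ((2 * d + 1).factorial : ℚ) :=
    Nat.choose_le_pow_div (2 * d + 1) n
  have hc0 : (0 : ℚ) ≤ (n.choose (2 * d + 1) : ℚ) := by positivity
  have hp : ((n : ℚ)) ^ (2 * (2 * d + 1)) ≤ ((m : ℚ) + 2) ^ (2 * d + 1) := by
    rw [pow_mul]
    have : ((n : ℚ)) ^ 2 ≤ (m : ℚ) + 2 := by exact_mod_cast h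
    exact pow_le_pow_left₀ (by positivity) this _
  have hdf1 : ((m : ℚ) + 2) ^ d ≤ (d.factorial : ℚ) * ((m + d + 1).choose d : ℚ) := by
    exact_mod_cast pow_le_factorial_mul_choose m d
  have hdf2 : ((m : ℚ) + 2) ^ (d + 1) ≤ ((d + 1).factorial : ℚ) * ((m + d + 2).choose (d + 1) : ℚ) := by
    have := pow_le_factorial_mul_choose m (d + 1)
    rw [show m + (d + 1) + 1 = m + d + 2 by ring] at this
    exact_mod_cast this
  have hf : 4 * ((d.factorial : ℚ) * ((d + 1).factorial : ℚ)) ≤ (((2 * d + 1).factorial : ℚ)) ^ 2 := by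
    exact_mod_cast four_mul_factorial_le_sq d hd
  have hf0 : (0 : ℚ) < (d.factorial : ℚ) := by positivity
  have hf1 : (0 : ℚ) < ((d + 1).factorial : ℚ) := by positivity
  have hf2 : (0 : ℚ) < ((2 * d + 1).factorial : ℚ) := by positivity
  have hm2 : (0 : ℚ) ≤ ((m : ℚ) + 2) ^ (2 * d + 1) := by positivity
  have hA : (0 : ℚ) ≤ ((m + d + 1).choose d : ℚ) := by positivity
  have hB : (0 : ℚ) ≤ ((m + d + 2).choose (d + 1) : ℚ) := by positivity
  calc 4 * (n.choose (2 * d + 1) : ℚ) ^ 2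
      ≤ 4 * ((n : ℚ) ^ (2 * d + 1) / ((2 * d + 1).factorial : ℚ)) ^ 2 := by gcongr
    _ = 4 * ((n : ℚ) ^ (2 * (2 * d + 1)) / (((2 * d + 1).factorial : ℚ)) ^ 2) := by
        rw [div_pow, ← pow_mul, mul_comm 2 (2 * d + 1)]
    _ ≤ 4 * (((m : ℚ) + 2) ^ (2 * d + 1) / (((2 * d + 1).factorial : ℚ)) ^ 2) := by gcongr
    _ ≤ 4 * (((m : ℚ) + 2) ^ (2 * d + 1) / (4 * ((d.factorial : ℚ) * ((d + 1).factorial : ℚ)))) := by gcongr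
    _ = ((m : ℚ) + 2) ^ d * ((m : ℚ) + 2) ^ (d + 1) / ((d.factorial : ℚ) * ((d + 1).factorial : ℚ)) := by
        rw [← pow_add, show d + (d + 1) = 2 * d + 1 by ring]; field_simp
    _ ≤ ((d.factorial : ℚ) * ((m + d + 1).choose d : ℚ)) * (((d + 1).factorial : ℚ) * ((m + d + 2).choose (d + 1) : ℚ))
          / ((d.factorial : ℚ) * ((d + 1).factorial : ℚ)) := by
        gcongr
    _ = ((m + d + 1).choose d : ℚ) * ((m + d + 2).choose (d + 1) : ℚ) := by field_simp

/-! ### §3 The monotone step on the band -/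

/-- **`C(u+k, k−1)·J_k(m) ≤ 1/4`** on the band `(u+k)² ≤ m + 2` (`k ≥ 5`): odd `k` through `diag_odd`, even `k` through
the log-convexity `J_k² ≤ J_{k−1}·J_{k+1}`. -/
lemma band_diag (k u m : ℕ) (hk : 5 ≤ k) (h2 : (u + k) ^ 2 ≤ m + 2) :
    ((u + k).choose (k - 1) : ℚ) * sliceS (m + 1) m k ≤ 1 / 4 := by
  obtain ⟨d, hd | hd⟩ : ∃ d, k = 2 * d + 1 ∨ k = 2 * d + 2 := by
    rcases Nat.even_or_odd k with ⟨d, hd⟩ | ⟨d, hd⟩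
    · exact ⟨d - 1, Or.inr (by omega)⟩
    · exact ⟨d, Or.inl (by omega)⟩
  · -- k = 2d + 1, d ≥ 2
    subst hd
    have hd1 : 1 ≤ d := by omega
    rw [diag_odd, show 2 * d + 1 - 1 = 2 * d by omega]
    have hb := band_odd d (u + (2 * d + 1)) m hd1 h2
    have hA : (0 : ℚ) < ((m + d + 1).choose d : ℚ) := Nat.cast_pos.mpr (Nat.choose_pos (by omega))
    rw [show ((u + (2 * d + 1)).choose (2 * d) : ℚ) * (1 / (2 * ((m + d + 1).choose d : ℚ)))
        = ((u + (2 * d + 1)).choose (2 * d) : ℚ) / (2 * ((m + d + 1).choose d : ℚ)) by ring,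
      div_le_div_iff₀ (by positivity) (by norm_num)]
    linarith
  · -- k = 2d + 2, d ≥ 2
    subst hd
    have hd1 : 1 ≤ d := by omega
    rw [show 2 * d + 2 - 1 = 2 * d + 1 by omega]
    have hsq := sliceS_sq_le (m + 1) m (2 * d + 1)
    rw [show 2 * d + 1 + 1 = 2 * d + 2 by ring, show 2 * d + 1 + 2 = 2 * (d + 1) + 1 by ring, diag_odd, diag_odd,
      show m + (d + 1) + 1 = m + d + 2 by ring] at hsq
    have hb := band_even d (u + (2 * d + 2)) m hd1 h2
    have hA : (0 : ℚ) < ((m + d + 1).choose d : ℚ) := Nat.cast_pos.mpr (Nat.choose_pos (by omega))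
    have hB : (0 : ℚ) < ((m + d + 2).choose (d + 1) : ℚ) := Nat.cast_pos.mpr (Nat.choose_pos (by omega))
    have hC : (0 : ℚ) ≤ ((u + (2 * d + 2)).choose (2 * d + 1) : ℚ) := by positivity
    have hJ : (0 : ℚ) ≤ sliceS (m + 1) m (2 * d + 2) := sliceS_nonneg _ _ _
    -- (C·J)² ≤ C²/(4AB) ≤ 1/16
    have hprod : (((u + (2 * d + 2)).choose (2 * d + 1) : ℚ) * sliceS (m + 1) m (2 * d + 2)) ^ 2 ≤ (1 / 4) ^ 2 := by
      calc (((u + (2 * d + 2)).choose (2 * d + 1) : ℚ) * sliceS (m + 1) m (2 * d + 2)) ^ 2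
          = ((u + (2 * d + 2)).choose (2 * d + 1) : ℚ) ^ 2 * sliceS (m + 1) m (2 * d + 2) ^ 2 := by ring
        _ ≤ ((u + (2 * d + 2)).choose (2 * d + 1) : ℚ) ^ 2
              * (1 / (2 * ((m + d + 1).choose d : ℚ)) * (1 / (2 * ((m + d + 2).choose (d + 1) : ℚ)))) := by
            gcongr
        _ = 4 * ((u + (2 * d + 2)).choose (2 * d + 1) : ℚ) ^ 2
              / (16 * (((m + d + 1).choose d : ℚ) * ((m + d + 2).choose (d + 1) : ℚ))) := by
            field_simp; ring
        _ ≤ (((m + d + 1).choose d : ℚ) * ((m + d + 2).choose (d + 1) : ℚ))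
              / (16 * (((m + d + 1).choose d : ℚ) * ((m + d + 2).choose (d + 1) : ℚ))) :=
            div_le_div_of_nonneg_right hb (by positivity)
        _ = (1 / 4) ^ 2 := by field_simp; ring
    nlinarith [hprod, mul_nonneg hC hJ]

/-- **The monotone step on the band** (`q = m + 1 + u`): `C(u+k, k−1)·S_k(q, m) ≤ S_1(q, m)` whenever `4u² ≤ m` and
`(u+k)² ≤ m + 2` (`k ≥ 5`). -/
lemma band_step (k u m : ℕ) (hk : 5 ≤ k) (h1 : 4 * u ^ 2 ≤ m) (h2 : (u + k) ^ 2 ≤ m + 2) :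
    ((u + k).choose (k - 1) : ℚ) * sliceS (m + 1 + u) m k ≤ sliceS (m + 1 + u) m 1 := by
  have hlow := sliceS_one_ge m u
  have hρ := diag_two_sq_le m
  have hρ0 : (0 : ℚ) ≤ 2 * sliceS (m + 1) m 2 := by
    have := sliceS_nonneg (m + 1) m 2; positivity
  have hu : (u : ℚ) * (2 * sliceS (m + 1) m 2) ≤ 1 / 2 := by
    have h1q : 4 * (u : ℚ) ^ 2 ≤ m := by exact_mod_cast h1
    have hsq : ((u : ℚ) * (2 * sliceS (m + 1) m 2)) ^ 2 ≤ (1 / 2) ^ 2 := by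
      calc ((u : ℚ) * (2 * sliceS (m + 1) m 2)) ^ 2 = (u : ℚ) ^ 2 * (2 * sliceS (m + 1) m 2) ^ 2 := by ring
        _ ≤ (u : ℚ) ^ 2 * (8 / (9 * ((m : ℚ) + 2))) := by gcongr
        _ ≤ (1 / 2) ^ 2 := by
            rw [show (u : ℚ) ^ 2 * (8 / (9 * ((m : ℚ) + 2))) = 8 * (u : ℚ) ^ 2 / (9 * ((m : ℚ) + 2)) by field_simp,
              div_le_iff₀ (by positivity)]
            nlinarith
    nlinarith [hsq, hρ0, mul_nonneg (Nat.cast_nonneg u) hρ0]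
  have hS1 : ((m + 1 + u : ℕ) : ℚ) / (4 * ((m : ℚ) + 1)) ≤ sliceS (m + 1 + u) m 1 := by
    have hy0 : (0 : ℚ) ≤ ((m + 1 + u : ℕ) : ℚ) / (2 * ((m : ℚ) + 1)) := by positivity
    have := mul_le_mul_of_nonneg_left hu hy0
    calc ((m + 1 + u : ℕ) : ℚ) / (4 * ((m : ℚ) + 1))
        = ((m + 1 + u : ℕ) : ℚ) / (2 * ((m : ℚ) + 1)) * (1 / 2) := by field_simp; ring
      _ ≤ ((m + 1 + u : ℕ) : ℚ) / (2 * ((m : ℚ) + 1)) * (1 - (u : ℚ) * (2 * sliceS (m + 1) m 2)) := by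
          nlinarith [this, hy0]
      _ ≤ sliceS (m + 1 + u) m 1 := hlow
  have hJ := band_diag k u m hk h2
  have hup := sliceS_le_diag m k (show m + 1 ≤ m + 1 + u by omega)
  have hx0 : (0 : ℚ) ≤ ((m + 1 + u : ℕ) : ℚ) / ((m : ℚ) + 1) := by positivity
  calc ((u + k).choose (k - 1) : ℚ) * sliceS (m + 1 + u) m k
      ≤ ((u + k).choose (k - 1) : ℚ) * (((m + 1 + u : ℕ) : ℚ) / ((m : ℚ) + 1) * sliceS (m + 1) m k) :=
        mul_le_mul_of_nonneg_left hup (by positivity)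
    _ = ((m + 1 + u : ℕ) : ℚ) / ((m : ℚ) + 1) * (((u + k).choose (k - 1) : ℚ) * sliceS (m + 1) m k) := by ring
    _ ≤ ((m + 1 + u : ℕ) : ℚ) / ((m : ℚ) + 1) * (1 / 4) := mul_le_mul_of_nonneg_left hJ hx0
    _ = ((m + 1 + u : ℕ) : ℚ) / (4 * ((m : ℚ) + 1)) := by field_simp
    _ ≤ sliceS (m + 1 + u) m 1 := hS1

/-! ### §4 The band theorem -/

/-- **THE SQUARE-ROOT BAND, by induction on the distance above the first untruncated slice**: for `k ≥ 5`, `u = k − 1 + t`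
and `4(u+k)² ≤ m`, `Φ(m+u+k, m+u) ≤ R̂(m+u, k, m)`. -/
theorem slice_band_aux (k : ℕ) (hk : 5 ≤ k) (t : ℕ) :
    ∀ m : ℕ, 4 * (k - 1 + t + k) ^ 2 ≤ m →
      phiK (m + (k - 1 + t) + k) (m + (k - 1 + t)) ≤ rhat (m + (k - 1 + t)) k m := by
  induction t with
  | zero =>
    intro m _
    have := first_untrunc_slice_every k (m + (k - 1 + 0)) hk (by omega)
    rwa [show m + (k - 1 + 0) - (k - 1) = m by omega] at this
  | succ t ih =>
    intro m hm
    have hm' : 4 * (k - 1 + t + k) ^ 2 ≤ m + 1 := by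
      have : (k - 1 + t + k) ^ 2 ≤ (k - 1 + (t + 1) + k) ^ 2 := Nat.pow_le_pow_left (by omega) 2
      omega
    have h1 := ih (m + 1) hm'
    have h2 := rhat_le_sliceL_of_untrunc (m + 1 + (k - 1 + t)) k (m + 1) (by omega)
    have hstep := band_step k (k - 1 + t) m hk
      (by
        have : (k - 1 + t) ^ 2 ≤ (k - 1 + (t + 1) + k) ^ 2 := Nat.pow_le_pow_left (by omega) 2
        omega)
      (by
        have : (k - 1 + t + k) ^ 2 ≤ (k - 1 + (t + 1) + k) ^ 2 := Nat.pow_le_pow_left (by omega) 2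
        omega)
    rw [show m + (k - 1 + (t + 1)) = m + 1 + (k - 1 + t) by omega]
    have h1' : phiK (m + 1 + (k - 1 + t) + k) (m + 1 + (k - 1 + t))
        ≤ ∑ j ∈ Finset.Ioo 0 k, ((m + 1 + (k - 1 + t) + k - (m + 1)).choose j : ℚ)
            * ∑ a ∈ range (m + 1 + 1), ((m + 1).choose a : ℚ) / ((m + 1 + (k - 1 + t) + j + a).choose (a + j) : ℚ) :=
      h1.trans h2
    exact phiK_le_rhat_of_sliceStep (k - 1 + t) k m (by omega) h1' hstep

/-- **THE SQUARE-ROOT BAND**: for every family `k ≥ 5` and every cell `(q+k, q)`, every slice `k − 1 ≤ u ≤ q` with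
`4(u+k)² ≤ q − u` is paid: `Φ(q+k, q) ≤ R̂(q, k, q − u)`. -/
theorem slice_band (k u q : ℕ) (hk : 5 ≤ k) (hu : k - 1 ≤ u) (huq : u ≤ q) (hm : 4 * (u + k) ^ 2 ≤ q - u) :
    phiK (q + k) q ≤ rhat q k (q - u) := by
  obtain ⟨t, rfl⟩ : ∃ t, u = k - 1 + t := ⟨u - (k - 1), by omega⟩
  obtain ⟨m, rfl⟩ : ∃ m, q = m + (k - 1 + t) := ⟨q - (k - 1 + t), by omega⟩
  rw [show m + (k - 1 + t) - (k - 1 + t) = m by omega]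
  exact slice_band_aux k hk t m (by rw [show m + (k - 1 + t) - (k - 1 + t) = m by omega] at hm; exact hm)

/-- **THE MATROID LEVEL OF THE BAND**: at the tight layer `#E = (q+k) + q` of every finite matroid (`k ≥ 5`), every member
`Z` of the cell `(q+k, q)` with `#(flatPart M Z) = q − u`, `k − 1 ≤ u ≤ q` and `4(u+k)² ≤ q − u` receives at least
`Φ(q+k, q)` under Rule Q's equal split. -/
theorem ruleQRecv_ge_phiK_band {β : Type} (M : Matroid β) [M.Finite] {q k u : ℕ} (hk : 5 ≤ k) (hu : k - 1 ≤ u)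
    (huq : u ≤ q) (hm : 4 * (u + k) ^ 2 ≤ q - u) (hE : M.E.ncard = (q + k) + q) {Z : Set β}
    (hZ : Z ∈ cellMembers M (q + k) q) (hP : (flatPart M Z).ncard = q - u) :
    phiK (q + k) q ≤ ruleQRecv M (q + k) q Z := by
  have h1 := slice_band k u q hk hu huq hm
  have h2 := rhat_le_ruleQRecv M hE hZ
  rw [hP] at h2
  exact h1.trans h2

end PercRepro
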